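/-
Copyright (c) 2026 the pub-hodgecm-mathlib formalisation cell (harness21).  Prover seat hodgecm-mathlib-K2E1-p16 (g2), Track B ∕ K2-LIT, h413 = `stmt-HodgeConjecture-24833`,
route of record `HCCMUnconditional`; R90-TF section S8 «ContSpec-n½» (dealer R90-CS-plan (g0), LEAD K2E1-plan (g7)), «U(Φ₃) χ-TWIN #3b» (TWIN-DAG v1 row 5 feeder «hunq_χ₃», law-free;
offered 16:12:51Z): the N = 3 twin of ★ `K2E1ChiUniquenessHunqCMTwo` (K2E1-p15 (g0)) over ★ `K2E1BLUniquenessU3` and `K2E1ChiHomogeneousL2U3` (this seat).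
-/
import Summits.HodgeConjecture.HodgeConjecture.Theorems.K2E1ChiUniquenessHunqCMTwo   -- ★ (K2E1-p15 g0): RANK-GENERIC §1 `hunq_of_memLp_of_lt_finDim`; brings ★ `K2E1BLUniquenessSelfAdjointU2` (`L²`-bridge, rank-generic)
import Summits.HodgeConjecture.HodgeConjecture.Theorems.K2E1ChiHomogeneousL2U3       -- (this seat, TWIN #3a): `hL2_chi_cm_three`
import Summits.HodgeConjecture.HodgeConjecture.Theorems.K2E1BLUniquenessU3           -- ★ p859028 (K2E1-p02): `uniqueSetSA_nonempty_three_of_lt` (`U₀ ≠ ∅` at rank 3 from `h(1) ≠ 0`)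
import HarnessLib

/-!
# K2·E1 — `K2E1ChiUniquenessHunqCMThree`: «L² + SELF-ADJOINT» UNIQUENESS FOR THE `(χ, τ)` `𝔛`-SYSTEM OF ONE BALL ON `U(2,1)_{L∕L⁺}`, AND THE LETTER `hunq` PAID (CM pair, `N = 3`)
# — the N = 3 twin of ★ `K2E1ChiUniquenessHunqCMTwo` (S8 «U(Φ₃) χ-TWIN» sheet, TWIN-DAG v1 row 5 feeder)

Track B ∕ K2-LIT, crux h413 = `stmt-HodgeConjecture-24833`; cell `hodgecm-mathlib`, R90-TF section S8.  THEOREMS ONLY (no `def`, no `instance`, no notation, no named-fact hypothesis, no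
`sorry`); lane `--kind proof --supports stmt-HodgeConjecture-24833 --as helper` (count-neutral).  Closes no socket.  INDEXING-FREE (RULING S8-R10 (a)): the cuspidal datum enters only
through the finite-dimensional constant-term family `Lz` and the letters `hδL`∕`hsol*`; no character law.

★ `K2E1ChiUniquenessHunqCMTwo` §1 `hunq_of_memLp_of_lt_finDim` is rank-generic (any `σ₀`, `U₀ ≠ ∅` as a hypothesis).  At `N = 3`: `σ₀ = 2` (the `U(2,1)` Godement abscissa), `U₀ ≠ ∅` from ★
`K2E1BLUniquenessU3.uniqueSetSA_nonempty_three_of_lt` (needs `2 < n + 2`, i.e. `0 < n` — the extra binder `hn`, exactly as in ★ `K2E1BLUniquenessSelfAdjointU3.hunq_of_memLp_three`), no `c² = 1`.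
* §2 **`hunq_of_memLp_three_finDim`** (`N = 3`, `σ₀ = 2`, `0 < n`).
* §3 **`hunq_chi_cm_three`** — the `hunq` letter of the N = 3 `(χ,τ)` ball BYTE-FOR-BYTE in the N = 2 shape with `2 ↦ 3`, `1 < Re z ↦ 2 < Re z`: §2 fed with `hL2_chi_cm_three`.
[BernsteinLapid2019, Thm 2.3, §4 Claim 2 (p. 9); MoeglinWaldspurger1995, IV.1.9.]
HONEST LABEL: HC_CM is proved only modulo the 7 printed citations (2 remaining named inputs: hLiu418 = `stmt-HodgeConjecture-24832`, h413 = `stmt-HodgeConjecture-24833`) until rung 0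
closes; this file asserts no named fact and closes no socket.

## References
* [BernsteinLapid2019] J. Bernstein, E. Lapid, *On the meromorphic continuation of Eisenstein series*, J. AMS 37 (2024) (arXiv:1911.02342), Thm 2.3, §4 Claim 2 (p. 9).
* [MoeglinWaldspurger1995] C. Mœglin, J.-L. Waldspurger, *Spectral Decomposition and Eisenstein Series* (1995), IV.1.9.
-/

set_option autoImplicit false
set_option linter.dupNamespace false  -- the mandated namespace repeats the summit's segment (`HodgeConjecture.HodgeConjecture`)

noncomputable section

open MeasureTheory Measure Set NumberField IsDedekindDomain Filter Topology Metric CompactlySupported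
open scoped NNReal ENNReal InnerProductSpace ComplexConjugate
open Literature.MeasureTheory.Group Literature.NumberTheory.Automorphic Literature.NumberTheory.Automorphic.UnitaryGroup AdelicGroupData
open Summit.HodgeConjecture.HodgeConjecture.Cruxes.H413.K2E1BLBorelSpacesU2Defs
open Summit.HodgeConjecture.HodgeConjecture.Cruxes.H413.K2E1BLBorelOperatorsU2Defs
open Summit.HodgeConjecture.HodgeConjecture.Cruxes.H413.K2E1BLUniquenessU3 (uniqueSetSA_nonempty_three_of_lt)
open Summit.HodgeConjecture.HodgeConjecture.Cruxes.H413.K2E1ChiUniquenessHunqCMTwo (hunq_of_memLp_of_lt_finDim)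
open Summit.HodgeConjecture.HodgeConjecture.Cruxes.H413.K2E1ChiHomogeneousL2U3 (hL2_chi_cm_three)

namespace Summit.HodgeConjecture.HodgeConjecture.Cruxes.H413.K2E1ChiUniquenessHunqCMThree

/-! ## §2 The `(χ, τ)` uniqueness head at `N = 3` (`σ₀ = 2`) -/

section Three

/-- **THE `(χ, τ)` UNIQUENESS HEAD AT `N = 3`** (`σ₀ = 2`, `0 < n` so that `U₀ ≠ ∅`; no `c² = 1` needed at rank 3): ★ RANK-GENERIC §1 `hunq_of_memLp_of_lt_finDim` with the non-emptiness of
`U₀` DISCHARGED by ★ `uniqueSetSA_nonempty_three_of_lt` from `Re h_{i₀} ≥ 0` and `h_{i₀}(1) ≠ 0` (automatic for `h = η^∨ ∗ η`) — exactly as ★ `K2E1BLUniquenessSelfAdjointU3.hunq_of_memLp_three`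
twins the spherical N = 2 head.  The single remaining letter is the `L²`-letter `hL2` (§3 pays it from ★ `K2E1ChiHomogeneousL2U3.hL2_chi_cm_three`). [cite: BernsteinLapid2019, §4 Claim 2 (p. 9), Thm 2.3] -/
theorem hunq_of_memLp_three_finDim {F E : Type} [Field F] [NumberField F] [Field E] [NumberField E] [Algebra F E] {c : E ≃ₐ[F] E}
    [MeasurableSpace (quasiSplit F E c 3).Adelic] [BorelSpace (quasiSplit F E c 3).Adelic]
    (μ : Measure (quasiSplit F E c 3).automorphicQuotient) [(quasiSplit F E c 3).IsAutomorphicMeasure μ]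
    (νG : Measure (quasiSplit F E c 3).Adelic) [νG.IsHaarMeasure] [νG.IsInvInvariant] (k n : ℕ) (hn : 0 < n) {I : Type*} (i₀ : I) {h : I → (quasiSplit F E c 3).Adelic → ℂ}
    (hhc : ∀ i, Continuous (h i)) (hhs : ∀ i, HasCompactSupport (h i)) (hsymm : ∀ g, h i₀ g⁻¹ = h i₀ g) (hreal : ∀ g, conj (h i₀ g) = h i₀ g)
    (h0 : ∀ g, 0 ≤ (h i₀ g).re) (hh1 : h i₀ 1 ≠ 0)
    (T : I → HX F E c 3 k μ →L[ℂ] HX F E c 3 k μ)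
    (hT : ∀ u : HX F E c 3 k μ, ((T i₀ u : HX F E c 3 k μ) : (quasiSplit F E c 3).automorphicQuotient → ℂ) =ᵐ[μ.withDensity fun x => (((supHeight F E c 3 x)⁻¹ ^ (2 * k) : ℝ≥0) : ℝ≥0∞)]
      fun ξ => ∫ y, h i₀ y * (u : (quasiSplit F E c 3).automorphicQuotient → ℂ) (y⁻¹ • ξ) ∂νG)
    {V : Type*} [NormedAddCommGroup V] [NormedSpace ℂ V] (ι : HX F E c 3 k μ →L[ℂ] V) (P : V →L[ℂ] V) (α₁ : ℂ → V)
    {B : Type*} [NormedAddCommGroup B] [NormedSpace ℂ B] (L : ℂ → B →L[ℂ] V)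
    {X' : Type*} [NormedAddCommGroup X'] [NormedSpace ℂ X'] (Q : HX F E c 3 k μ →L[ℂ] X') (φ₀ : ℂ) (eX : ℂ → HX F E c 3 k μ) (bX : ℂ → B)
    (hsolT : ∀ z ∈ ball (0 : ℂ) (n + 2), 2 < z.re → ∀ i, T i (eX z) = (∫ x, h i x * (((borelHeight x : ℝ≥0) : ℝ) : ℂ) ^ z ∂νG) • eX z)
    (hsolC : ∀ z ∈ ball (0 : ℂ) (n + 2), 2 < z.re → P (ι (eX z)) = φ₀ • α₁ z + L z (bX z))
    (hsolQ : ∀ z ∈ ball (0 : ℂ) (n + 2), 2 < z.re → Q (eX z) = 0)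
    (hL2 : ∀ z ∈ ball (0 : ℂ) (n + 2), 2 < z.re → (∫ x, h i₀ x * (((borelHeight x : ℝ≥0) : ℝ) : ℂ) ^ z ∂νG).im ≠ 0 →
      ∀ (ψ : HX F E c 3 k μ) (b' : B), (∀ i, T i ψ = (∫ x, h i x * (((borelHeight x : ℝ≥0) : ℝ) : ℂ) ^ z ∂νG) • ψ) → P (ι ψ) = L z b' → Q ψ = 0 →
        MemLp (ψ : (quasiSplit F E c 3).automorphicQuotient → ℂ) 2 μ) :
    ∃ U₀ : Set ℂ, IsOpen U₀ ∧ U₀.Nonempty ∧ U₀ ⊆ ball (0 : ℂ) (n + 2) ∩ {z : ℂ | 2 < z.re} ∧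
      ∀ z ∈ U₀, ∀ (ψ : HX F E c 3 k μ) (b : B), (∀ i, T i ψ = (∫ x, h i x * (((borelHeight x : ℝ≥0) : ℝ) : ℂ) ^ z ∂νG) • ψ) →
        P (ι ψ) = φ₀ • α₁ z + L z b → Q ψ = 0 → ψ = eX z := by
  have hre : ∀ g, (((h i₀ g).re : ℝ) : ℂ) = h i₀ g := fun g => Complex.conj_eq_iff_re.1 (hreal g)
  refine hunq_of_memLp_of_lt_finDim μ νG k 2 n i₀ hhc hhs hsymm hreal ?_ T hT ι P α₁ L Q φ₀ eX bX hsolT hsolC hsolQ hL2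
  have hn' : (2 : ℝ) < n + 2 := by
    have : (0 : ℝ) < n := Nat.cast_pos.2 hn
    linarith
  have hne := uniqueSetSA_nonempty_three_of_lt νG (h := fun g => (h i₀ g).re) (Complex.continuous_re.comp (hhc i₀)) ((hhs i₀).comp_left Complex.zero_re) h0
    (fun h01 => hh1 (by rw [← hre 1, h01, Complex.ofReal_zero])) 2 n hn'
  have hfun : h i₀ = fun g => (((h i₀ g).re : ℝ) : ℂ) := funext fun g => (hre g).symm
  rw [hfun]
  exact hne

end Three

/-! ## §3 THE LETTER `hunq` of the N = 3 `(χ,τ)` ball, PAID for the CM pair at `N = 3` -/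

section CM

variable (L : Type) [Field L] [NumberField L] [IsCMField L]
  [MeasurableSpace (quasiSplit (↥(maximalRealSubfield L)) L (IsCMField.complexConj L) 3).Adelic]
  [BorelSpace (quasiSplit (↥(maximalRealSubfield L)) L (IsCMField.complexConj L) 3).Adelic]

/-- **THE `hunq` LETTER FOR THE `(χ, τ)` BALL AT THE CM PAIR, `N = 3`, ONE CALL** (`σ₀ = 2`, `0 < n`) — the `hunq` slot of the RANK-GENERIC X1_χ ★ `K2E1ChiEisensteinMeromorphicBallU2`∕
`…ExportsU2` read at `N = 3` (`ι := iota hb`, `P := cnstN k a μZ`, constant term `φ₀ • α₁ z + Lz z b`); the proof is §2 fed with ★ `K2E1ChiHomogeneousL2U3.hL2_chi_cm_three`.  The N = 3 twin of ★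
`hunq_chi_cm_two`.  Letters left to the caller: `hT`∕`hδι` (★ P3-C `exists_heckePackage′`, rank-generic), `hK1` at `i₀` (N = 3 cusp decay), `hδL` (★ rank-generic `K2E1ChiHomogeneousL2U2` §2), `hsolT hsolC hsolQ`
(the N = 3 `(χ,τ)` solution, TWIN-DAG row 4). [cite: BernsteinLapid2019, Thm 2.3 and §4 Claim 2 (p. 9)] [cite: MoeglinWaldspurger1995, IV.1.9] -/
theorem hunq_chi_cm_three
    (μ : Measure (quasiSplit (↥(maximalRealSubfield L)) L (IsCMField.complexConj L) 3).automorphicQuotient)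
    [(quasiSplit (↥(maximalRealSubfield L)) L (IsCMField.complexConj L) 3).IsAutomorphicMeasure μ]
    (νG : Measure (quasiSplit (↥(maximalRealSubfield L)) L (IsCMField.complexConj L) 3).Adelic) [νG.IsHaarMeasure] [νG.IsInvInvariant]
    {β : (quasiSplit (↥(maximalRealSubfield L)) L (IsCMField.complexConj L) 3).Adelic → ℝ≥0∞}
    (hβ : IsCoveringWeight ↥((arithmeticBorel (↥(maximalRealSubfield L)) L (IsCMField.complexConj L) 3).map
      (quasiSplit (↥(maximalRealSubfield L)) L (IsCMField.complexConj L) 3).arithmeticSubgroup.subtype) β)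
    {μZ : Measure (borelQuotient (↥(maximalRealSubfield L)) L (IsCMField.complexConj L) 3)}
    (hμZ : ∀ f : borelQuotient (↥(maximalRealSubfield L)) L (IsCMField.complexConj L) 3 → ℝ≥0∞, Measurable f →
      ∫⁻ z, f z ∂μZ = ∫⁻ g, β g * f (toBorelQuotient (↥(maximalRealSubfield L)) L (IsCMField.complexConj L) 3 g) ∂νG)
    (k n : ℕ) (hn : 0 < n) {I : Type*} (i₀ : I) {h : I → (quasiSplit (↥(maximalRealSubfield L)) L (IsCMField.complexConj L) 3).Adelic → ℂ}
    (hhc : ∀ i, Continuous (h i)) (hhs : ∀ i, HasCompactSupport (h i)) (hsymm : ∀ g, h i₀ g⁻¹ = h i₀ g) (hreal : ∀ g, conj (h i₀ g) = h i₀ g)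
    (h0 : ∀ g, 0 ≤ (h i₀ g).re) (hh1 : h i₀ 1 ≠ 0)
    {a a₀ : ℝ≥0} (ha₀ : 0 < a₀) (haa₀ : a ≤ a₀) (hfin : μZ {z | a < borelQuotHeight (↥(maximalRealSubfield L)) L (IsCMField.complexConj L) 3 z} ≠ ∞)
    (hb : IotaBound (↥(maximalRealSubfield L)) L (IsCMField.complexConj L) 3 k a μ μZ)
    (hs : ShiftBound (↥(maximalRealSubfield L)) L (IsCMField.complexConj L) 3 k a a₀ νG μZ (h i₀))
    (T : I → HX (↥(maximalRealSubfield L)) L (IsCMField.complexConj L) 3 k μ →L[ℂ] HX (↥(maximalRealSubfield L)) L (IsCMField.complexConj L) 3 k μ)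
    (hT : ∀ u : HX (↥(maximalRealSubfield L)) L (IsCMField.complexConj L) 3 k μ,
      ((T i₀ u : HX (↥(maximalRealSubfield L)) L (IsCMField.complexConj L) 3 k μ) : (quasiSplit (↥(maximalRealSubfield L)) L (IsCMField.complexConj L) 3).automorphicQuotient → ℂ)
        =ᵐ[μ.withDensity fun x => (((supHeight (↥(maximalRealSubfield L)) L (IsCMField.complexConj L) 3 x)⁻¹ ^ (2 * k) : ℝ≥0) : ℝ≥0∞)]
      fun ξ => ∫ y, h i₀ y * (u : (quasiSplit (↥(maximalRealSubfield L)) L (IsCMField.complexConj L) 3).automorphicQuotient → ℂ) (y⁻¹ • ξ) ∂νG)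
    (hδι : deltaShift hs ∘L iota hb = restrHN (↥(maximalRealSubfield L)) L (IsCMField.complexConj L) 3 k haa₀ μZ ∘L iota hb ∘L T i₀)
    {C m : ℝ} (hC : 0 ≤ C) (hm : 0 ≤ m)
    (hK1 : ∀ f : HNcusp (↥(maximalRealSubfield L)) L (IsCMField.complexConj L) 3 k a μZ,
      ∀ᵐ x ∂(weightedTruncMeasure (↥(maximalRealSubfield L)) L (IsCMField.complexConj L) 3 k a₀ μZ),
        ‖rightConvFun (↥(maximalRealSubfield L)) L (IsCMField.complexConj L) 3 νG (h i₀)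
            ((f : HN (↥(maximalRealSubfield L)) L (IsCMField.complexConj L) 3 k a μZ) : borelQuotient (↥(maximalRealSubfield L)) L (IsCMField.complexConj L) 3 → ℂ) x‖ ≤
          C * ‖f‖ * ((borelQuotHeight (↥(maximalRealSubfield L)) L (IsCMField.complexConj L) 3 x : ℝ)) ^ (-m))
    (α₁ : ℂ → HN (↥(maximalRealSubfield L)) L (IsCMField.complexConj L) 3 k a μZ)
    {B : Type*} [NormedAddCommGroup B] [NormedSpace ℂ B] (Lz : ℂ → B →L[ℂ] HN (↥(maximalRealSubfield L)) L (IsCMField.complexConj L) 3 k a μZ)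
    (hδL : ∀ z ∈ ball (0 : ℂ) (n + 2), 2 < z.re → ∀ b' : B, ∃ M : ℝ, ∀ᵐ x ∂(weightedTruncMeasure (↥(maximalRealSubfield L)) L (IsCMField.complexConj L) 3 k a₀ μZ),
      ‖(deltaShift hs (Lz z b') : borelQuotient (↥(maximalRealSubfield L)) L (IsCMField.complexConj L) 3 → ℂ) x‖ ≤ M)
    {X' : Type*} [NormedAddCommGroup X'] [NormedSpace ℂ X'] (Q : HX (↥(maximalRealSubfield L)) L (IsCMField.complexConj L) 3 k μ →L[ℂ] X') (φ₀ : ℂ)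
    (eX : ℂ → HX (↥(maximalRealSubfield L)) L (IsCMField.complexConj L) 3 k μ) (bX : ℂ → B)
    (hsolT : ∀ z ∈ ball (0 : ℂ) (n + 2), 2 < z.re → ∀ i, T i (eX z) = (∫ x, h i x * (((borelHeight x : ℝ≥0) : ℝ) : ℂ) ^ z ∂νG) • eX z)
    (hsolC : ∀ z ∈ ball (0 : ℂ) (n + 2), 2 < z.re →
      cnstN (↥(maximalRealSubfield L)) L (IsCMField.complexConj L) 3 k a μZ (iota hb (eX z)) = φ₀ • α₁ z + Lz z (bX z))
    (hsolQ : ∀ z ∈ ball (0 : ℂ) (n + 2), 2 < z.re → Q (eX z) = 0) :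
    ∃ U₀ : Set ℂ, IsOpen U₀ ∧ U₀.Nonempty ∧ U₀ ⊆ ball (0 : ℂ) (n + 2) ∩ {z : ℂ | 2 < z.re} ∧
      ∀ z ∈ U₀, ∀ (ψ : HX (↥(maximalRealSubfield L)) L (IsCMField.complexConj L) 3 k μ) (b : B),
        (∀ i, T i ψ = (∫ x, h i x * (((borelHeight x : ℝ≥0) : ℝ) : ℂ) ^ z ∂νG) • ψ) →
          cnstN (↥(maximalRealSubfield L)) L (IsCMField.complexConj L) 3 k a μZ (iota hb ψ) = φ₀ • α₁ z + Lz z b → Q ψ = 0 → ψ = eX z :=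
  hunq_of_memLp_three_finDim μ νG k n hn i₀ hhc hhs hsymm hreal h0 hh1 T hT (iota hb) (cnstN (↥(maximalRealSubfield L)) L (IsCMField.complexConj L) 3 k a μZ) α₁ Lz Q φ₀ eX bX hsolT hsolC hsolQ
    (hL2_chi_cm_three L μ νG hβ hμZ k n i₀ ha₀ haa₀ hfin hb hs T hδι hC hm hK1 Lz hδL Q)

end CM

end Summit.HodgeConjecture.HodgeConjecture.Cruxes.H413.K2E1ChiUniquenessHunqCMThree

end
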